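import Summits.AtomisticToContinuum.BoseEinsteinCondensation.Theorems.BECCutLineWeakDisorderGroundStateRigidityStubCoreCutoff
import Summits.AtomisticToContinuum.BoseEinsteinCondensation.Theorems.BECCutLineWeakDisorderGroundStateRigidityStubLayerKineticVanishing
import Summits.AtomisticToContinuum.BoseEinsteinCondensation.Theorems.BECCutLineWeakDisorderGroundStateRigidityStubWallCutAux
import Literature.MathematicalPhysics.QuantumManyBody.BoseGasHardSet
import Literature.MathematicalPhysics.QuantumManyBody.PeriodicMultiplierKineticBound
import HarnessLib

/-!
# Crux `GroundStateRigidity` (stmt-AtomisticToContinuum-9072), line `zoo_reduction`: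
# the registered stub `stub_wallCut` (CUT)

Supports (does not close) stmt-AtomisticToContinuum-9072; registered stub `stub_wallCut` (CUT) of
line `zoo_reduction` (lead c5). **Splitting a finite-energy trial state across a wall.** Let
`b > 0` be a hard radius of the measurable pair potential `v` and `Φ` a trial state of finite
`v`-energy. For every `ε > 0` there are `C¹`, Dirichlet, Bose-symmetric `f_U`, `f_B` with `f_U = 0`
wherever some pair is at distance `≤ b`, `f_B = 0` wherever all pairs are at distance `≥ b`,
`‖Φ − (f_U + f_B)‖₂² ≤ ε` and `𝓔_v[f_U] + 𝓔_v[f_B] ≤ energy v Φ + ε` (`𝓔_v = rawEnergy v`).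

## Proof

`ψ = Φ.ψ` is continuous of finite raw energy, so it VANISHES on the wall
`{∃ i ≠ j, |xᵢ - xⱼ| = b}` (`eq_zero_of_dist_mem_hardRad`). With the pair cutoffs of the landed
Stub 15a `stub_coreCutoff` (constant `A = A(N)`): `χ` at radii `(b + δ, b + 2δ)` and `χ'` at
radii `(b - 2δ, b - δ)`; put `f_U = χψ`, `f_B = (1 - χ')ψ`. Then `χ = 0 ∨ χ' = 1` pointwise
(nesting), `χ = χ'` off the layer `Λ_δ = {∃ i ≠ j, b - 2δ < |xᵢ - xⱼ| < b + 2δ}`, and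
`|∇χ|², |∇χ'|² ≤ (A/δ²) 1_{Λ_δ}`. Pointwise (`WallCut.energy_pt`, from the IMS/Young multiplier
bound `kineticDensity_ofReal_mul_le`):
`(|∇f_U|² + V|f_U|²) + (|∇f_B|² + V|f_B|²) ≤ (1+θ)(|∇ψ|² + V|ψ|²) + 2(1+θ⁻¹)(A/δ²) 1_{Λ_δ}|ψ|²`
and `|ψ − f_U − f_B|² = (χ' − χ)²|ψ|² ≤ 1_{Λ_δ}|ψ|²` (`WallCut.dist_pt`). The WALL-LAYER Poincaré
inequality of the auxiliary file (`WallCut.lintegral_wallLayer_le`, radius `b - 2δ`, width `4δ`,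
wall `b`, `82δ ≤ b`) gives `∫ 1_{Λ_δ}|ψ|² ≤ N² · 144δ² ∫ 1_{Λ_δ}|∇ψ|²`, and the layer kinetic
energy is `≤ τ` for `2δ ≤ s(τ)` by the landed `stub_layerKineticVanishing`. Choosing `θ` with
`θ · energy ≤ ε/2`, then `τ` with `(2(1+θ⁻¹) · 144 A N² + 144 (b/82)² N²) τ ≤ ε/2`, then `δ`,
both errors are `≤ ε`. [LSSY2005, proof of Thm 2.4 (cutting off the hard-core shell)]
-/

noncomputable section

open MeasureTheory Set Metric
open scoped ENNReal NNReal

namespace Summit.AtomisticToContinuum.BoseEinsteinCondensation.Theorems.GroundStateRigidity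

open Literature.MathematicalPhysics.QuantumManyBody.BoseGas

namespace WallCut

variable {N : ℕ}

/-! ### Pointwise bounds for the two cut pieces -/

/-- `|∇(1 - χ)|² = |∇χ|²`. [folklore] -/
theorem realKinetic_one_sub (χ : Config N → ℝ) (X : Config N) :
    realKinetic (fun Y => 1 - χ Y) X = realKinetic χ X := by
  unfold realKinetic
  refine Finset.sum_congr rfl fun i _ => Finset.sum_congr rfl fun k _ => ?_
  rw [fderiv_const_sub, neg_apply, nnnorm_neg]

/-- **Kinetic bound for one cut piece** `ξψ` with a gradient bound `|∇ξ|² ≤ G 1_Λ`: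
`|∇(ξψ)|² ≤ (1+θ) ξ² |∇ψ|² + (1+θ⁻¹) G 1_Λ |ψ|²` (IMS/Young multiplier bound
`kineticDensity_ofReal_mul_le`). [cite: LSSY2005, proof of Thm 2.4] -/
theorem kinetic_cut_pt {ψ : Config N → ℂ} {ξ : Config N → ℝ} (hψ : Differentiable ℝ ψ)
    (hξ : Differentiable ℝ ξ) {θ : ℝ} (hθ : 0 < θ) {Λ : Set (Config N)} {G : ℝ≥0∞}
    (hG : ∀ X, realKinetic ξ X ≤ Λ.indicator (fun _ => G) X) (X : Config N) :
    kineticDensity (fun Y => (ξ Y : ℂ) * ψ Y) X ≤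
      ENNReal.ofReal (1 + θ) * ENNReal.ofReal (ξ X ^ 2) * kineticDensity ψ X +
        ENNReal.ofReal (1 + θ⁻¹) * G * Λ.indicator (fun Y => (‖ψ Y‖₊ : ℝ≥0∞) ^ 2) X := by
  refine (kineticDensity_ofReal_mul_le (hψ X) (hξ X) hθ).trans (add_le_add ?_ ?_)
  · rw [ENNReal.ofReal_mul (by positivity)]
  · rw [kineticDensity_ofReal hξ X, mul_assoc, mul_assoc]
    refine mul_le_mul' le_rfl ?_
    have h := hG X
    by_cases hX : X ∈ Λ
    · rw [indicator_of_mem hX] at h ⊢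
      calc (‖ψ X‖₊ : ℝ≥0∞) ^ 2 * realKinetic ξ X ≤ (‖ψ X‖₊ : ℝ≥0∞) ^ 2 * G :=
            mul_le_mul' le_rfl h
        _ = G * (‖ψ X‖₊ : ℝ≥0∞) ^ 2 := mul_comm _ _
    · rw [indicator_of_notMem hX, nonpos_iff_eq_zero] at h
      rw [h, mul_zero]
      exact zero_le

/-- **Pointwise form bound for the wall splitting.** For `χ, χ' ∈ [0,1]` with `χ = 0 ∨ χ' = 1`
pointwise and `|∇χ|², |∇χ'|² ≤ G 1_Λ`, the pieces `f_U = χψ`, `f_B = (1 - χ')ψ` satisfy, for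
every weight `W ≥ 0` (the interaction) and `θ > 0`,
`(|∇f_U|² + W|f_U|²) + (|∇f_B|² + W|f_B|²) ≤ (1+θ)(|∇ψ|² + W|ψ|²) + 2(1+θ⁻¹) G 1_Λ |ψ|²`
(`χ² + (1-χ')² ≤ 1`). [cite: LSSY2005, proof of Thm 2.4] -/
theorem energy_pt {ψ : Config N → ℂ} {χ χ' : Config N → ℝ} (hψ : Differentiable ℝ ψ)
    (hχ : Differentiable ℝ χ) (hχ' : Differentiable ℝ χ')
    (h01 : ∀ X, 0 ≤ χ X ∧ χ X ≤ 1) (h01' : ∀ X, 0 ≤ χ' X ∧ χ' X ≤ 1)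
    (hnest : ∀ X, χ X = 0 ∨ χ' X = 1) {θ : ℝ} (hθ : 0 < θ) {Λ : Set (Config N)} {G : ℝ≥0∞}
    (hG : ∀ X, realKinetic χ X ≤ Λ.indicator (fun _ => G) X)
    (hG' : ∀ X, realKinetic χ' X ≤ Λ.indicator (fun _ => G) X)
    (W : Config N → ℝ≥0∞) (X : Config N) :
    (kineticDensity (fun Y => (χ Y : ℂ) * ψ Y) X +
        W X * (‖(χ X : ℂ) * ψ X‖₊ : ℝ≥0∞) ^ 2) +
      (kineticDensity (fun Y => ((1 - χ' Y : ℝ) : ℂ) * ψ Y) X +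
        W X * (‖((1 - χ' X : ℝ) : ℂ) * ψ X‖₊ : ℝ≥0∞) ^ 2) ≤
      ENNReal.ofReal (1 + θ) * (kineticDensity ψ X + W X * (‖ψ X‖₊ : ℝ≥0∞) ^ 2) +
        2 * (ENNReal.ofReal (1 + θ⁻¹) * G) * Λ.indicator (fun Y => (‖ψ Y‖₊ : ℝ≥0∞) ^ 2) X := by
  have hξ : Differentiable ℝ fun Y => 1 - χ' Y := hχ'.const_sub 1
  have hGξ : ∀ Y, realKinetic (fun Z => 1 - χ' Z) Y ≤ Λ.indicator (fun _ => G) Y := fun Y => by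
    rw [realKinetic_one_sub]; exact hG' Y
  have hk1 := kinetic_cut_pt hψ hχ hθ hG X
  have hk2 := kinetic_cut_pt hψ hξ hθ hGξ X
  -- the weights add up to at most one
  have hP1 : ENNReal.ofReal (χ X ^ 2) + ENNReal.ofReal ((1 - χ' X) ^ 2) ≤ 1 := by
    rw [← ENNReal.ofReal_add (sq_nonneg _) (sq_nonneg _), ← ENNReal.ofReal_one]
    refine ENNReal.ofReal_le_ofReal ?_
    rcases hnest X with h0 | h1
    · rw [h0]; nlinarith [(h01' X).1, (h01' X).2]
    · rw [h1]; nlinarith [(h01 X).1, (h01 X).2]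
  have hθ1 : (1 : ℝ≥0∞) ≤ ENNReal.ofReal (1 + θ) := by
    rw [← ENNReal.ofReal_one]; exact ENNReal.ofReal_le_ofReal (by linarith)
  set S : ℝ≥0∞ := (‖ψ X‖₊ : ℝ≥0∞) ^ 2 with hS
  set I : ℝ≥0∞ := Λ.indicator (fun Y => (‖ψ Y‖₊ : ℝ≥0∞) ^ 2) X with hI
  have hW : W X * S ≤ ENNReal.ofReal (1 + θ) * (W X * S) := by
    calc W X * S = 1 * (W X * S) := (one_mul _).symm
      _ ≤ _ := mul_le_mul' hθ1 le_rfl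
  -- `|r z|² = r² |z|²` for a real multiplier
  have hmul : ∀ (r : ℝ) (z : ℂ),
      ((‖(r : ℂ) * z‖₊ : ℝ≥0∞)) ^ 2 = ENNReal.ofReal (r ^ 2) * (‖z‖₊ : ℝ≥0∞) ^ 2 := by
    intro r z
    rw [nnnorm_mul, ENNReal.coe_mul, mul_pow, ← ENNReal.coe_pow, ← ENNReal.ofReal_coe_nnreal,
      NNReal.coe_pow, coe_nnnorm, Complex.norm_real, Real.norm_eq_abs, sq_abs]
  rw [hmul, hmul]
  calc _ ≤ (ENNReal.ofReal (1 + θ) * ENNReal.ofReal (χ X ^ 2) * kineticDensity ψ X +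
          ENNReal.ofReal (1 + θ⁻¹) * G * I + W X * (ENNReal.ofReal (χ X ^ 2) * S)) +
        (ENNReal.ofReal (1 + θ) * ENNReal.ofReal ((1 - χ' X) ^ 2) * kineticDensity ψ X +
          ENNReal.ofReal (1 + θ⁻¹) * G * I + W X * (ENNReal.ofReal ((1 - χ' X) ^ 2) * S)) :=
        add_le_add (add_le_add hk1 le_rfl) (add_le_add hk2 le_rfl)
    _ = (ENNReal.ofReal (χ X ^ 2) + ENNReal.ofReal ((1 - χ' X) ^ 2)) *
          (ENNReal.ofReal (1 + θ) * kineticDensity ψ X + W X * S) +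
        2 * (ENNReal.ofReal (1 + θ⁻¹) * G) * I := by ring
    _ ≤ 1 * (ENNReal.ofReal (1 + θ) * kineticDensity ψ X + ENNReal.ofReal (1 + θ) * (W X * S)) +
        2 * (ENNReal.ofReal (1 + θ⁻¹) * G) * I :=
        add_le_add (mul_le_mul' hP1 (add_le_add le_rfl hW)) le_rfl
    _ = _ := by ring

/-- **Pointwise distance bound for the wall splitting**: with `χ, χ' ∈ [0,1]` equal off `Λ`,
`|ψ − (χψ + (1 − χ')ψ)|² = (χ' − χ)²|ψ|² ≤ 1_Λ |ψ|²`. [folklore] -/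
theorem dist_pt {ψ : Config N → ℂ} {χ χ' : Config N → ℝ}
    (h01 : ∀ X, 0 ≤ χ X ∧ χ X ≤ 1) (h01' : ∀ X, 0 ≤ χ' X ∧ χ' X ≤ 1)
    {Λ : Set (Config N)} (hΛ : ∀ X, X ∉ Λ → χ X = χ' X) (X : Config N) :
    (‖ψ X - ((χ X : ℂ) * ψ X + ((1 - χ' X : ℝ) : ℂ) * ψ X)‖₊ : ℝ≥0∞) ^ 2 ≤
      Λ.indicator (fun Y => (‖ψ Y‖₊ : ℝ≥0∞) ^ 2) X := by
  have hid : ψ X - ((χ X : ℂ) * ψ X + ((1 - χ' X : ℝ) : ℂ) * ψ X) =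
      ((χ' X - χ X : ℝ) : ℂ) * ψ X := by
    push_cast
    ring
  rw [hid, nnnorm_mul, ENNReal.coe_mul, mul_pow, ← ENNReal.coe_pow (‖((χ' X - χ X : ℝ) : ℂ)‖₊),
    ← ENNReal.ofReal_coe_nnreal, NNReal.coe_pow, coe_nnnorm, Complex.norm_real, Real.norm_eq_abs,
    sq_abs]
  by_cases hX : X ∈ Λ
  · rw [indicator_of_mem hX]
    have h1 : χ' X - χ X ≤ 1 := by linarith [(h01 X).1, (h01' X).2]
    have h2 : -1 ≤ χ' X - χ X := by linarith [(h01 X).2, (h01' X).1]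
    calc ENNReal.ofReal ((χ' X - χ X) ^ 2) * (‖ψ X‖₊ : ℝ≥0∞) ^ 2
        ≤ 1 * (‖ψ X‖₊ : ℝ≥0∞) ^ 2 := by
          refine mul_le_mul' ?_ le_rfl
          rw [← ENNReal.ofReal_one]
          exact ENNReal.ofReal_le_ofReal (by nlinarith [h1, h2])
      _ = _ := one_mul _
  · rw [indicator_of_notMem hX, hΛ X hX, sub_self]
    simp

end WallCut

/-! ### The stub -/

open WallCut in
/-- **Stub CUT (`stub_wallCut`) of line `zoo_reduction` — splitting a finite-energy trial state
across a wall.** Let `b > 0` be a hard radius of the measurable potential `v` and `Φ` a trial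
state of finite `v`-energy. For every `ε > 0` there are two `C¹`, Dirichlet, Bose-symmetric
functions `f_U`, `f_B` with `f_U = 0` wherever some pair is at distance `≤ b`, `f_B = 0` wherever
all pairs are at distance `≥ b`, `‖Φ − (f_U + f_B)‖₂² ≤ ε` and
`𝓔_v[f_U] + 𝓔_v[f_B] ≤ energy v Φ + ε`. Proof: `Φ.ψ` vanishes on the wall
(`eq_zero_of_dist_mem_hardRad`); `f_U = χ Φ.ψ`, `f_B = (1 − χ') Φ.ψ` with the pair cutoffs of
`stub_coreCutoff` at radii `(b + δ, b + 2δ)` and `(b − 2δ, b − δ)`; pointwise form and distance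
bounds `WallCut.energy_pt`, `WallCut.dist_pt`; the layer mass is `≤ 144 N² δ² ×` (layer kinetic
energy) by the wall-layer Poincaré inequality `WallCut.lintegral_wallLayer_le`, and the layer
kinetic energy is small by `stub_layerKineticVanishing`; take `θ`, then the layer tolerance, then
`δ` small. [cite: LSSY2005, proof of Thm 2.4] -/
theorem stub_wallCut :
    ∀ (N : ℕ) (v : ℝ → ℝ≥0∞) (L b ε : ℝ), Measurable v → 0 < b → b ∈ hardRad v → 0 < ε →
      ∀ Φ : TrialState N L, energy v Φ ≠ ⊤ →
      ∃ fU fB : Config N → ℂ, ContDiff ℝ 1 fU ∧ ContDiff ℝ 1 fB ∧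
        (∀ X, X ∉ boxN N L → fU X = 0) ∧ (∀ X, X ∉ boxN N L → fB X = 0) ∧
        (∀ (σ : Equiv.Perm (Fin N)) (X : Config N), fU (X ∘ σ) = fU X) ∧
        (∀ (σ : Equiv.Perm (Fin N)) (X : Config N), fB (X ∘ σ) = fB X) ∧
        (∀ X : Config N, (∃ i j : Fin N, i ≠ j ∧ dist (X i) (X j) ≤ b) → fU X = 0) ∧
        (∀ X : Config N, (∀ i j : Fin N, i ≠ j → b ≤ dist (X i) (X j)) → fB X = 0) ∧
        ∫⁻ X, (‖Φ.ψ X - (fU X + fB X)‖₊ : ℝ≥0∞) ^ 2 ≤ ENNReal.ofReal ε ∧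
        rawEnergy v fU + rawEnergy v fB ≤ energy v Φ + ENNReal.ofReal ε := by
  intro N v L b ε hv hb hbH hε Φ hE
  -- the wave function, its energy, its zero on the wall
  set ψ : Config N → ℂ := Φ.ψ with hψ_def
  have hψC : ContDiff ℝ 1 ψ := Φ.contDiff
  have hψd : Differentiable ℝ ψ := hψC.differentiable one_ne_zero
  have hψ0 : ∀ X, X ∉ boxN N L → ψ X = 0 := Φ.eq_zero
  have hψσ : ∀ (σ : Equiv.Perm (Fin N)) (X : Config N), ψ (X ∘ σ) = ψ X := Φ.symm
  set E : ℝ≥0∞ := energy v Φ with hE_def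
  have hkin : ∫⁻ X, kineticDensity ψ X ≠ ⊤ :=
    ne_top_of_le_ne_top hE (lintegral_mono fun X => le_self_add)
  have hzero : ∀ (X : Config N) (i j : Fin N), i ≠ j → dist (X i) (X j) = b → ψ X = 0 :=
    fun X i j hij hd => eq_zero_of_dist_mem_hardRad hv hψC.continuous hE hij (by rw [hd]; exact hbH)
  -- the tolerance `ε'` and the parameter `θ` with `θ E ≤ ε/2`
  set ε' : ℝ≥0∞ := ENNReal.ofReal ε with hε'
  have hε'0 : ε' ≠ 0 := (ENNReal.ofReal_pos.2 hε).ne'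
  have hε2 : ε' / 2 ≠ 0 := (ENNReal.div_pos hε'0 ENNReal.ofNat_ne_top).ne'
  obtain ⟨θ, hθ_def⟩ : ∃ θ : ℝ, θ = ε / (2 * (E.toReal + 1)) := ⟨_, rfl⟩
  have hθ : 0 < θ := by rw [hθ_def]; positivity
  have hθE : ENNReal.ofReal θ * E ≤ ε' / 2 := by
    rw [← ENNReal.ofReal_toReal hE, ← ENNReal.ofReal_mul hθ.le, hε', ← ENNReal.ofReal_ofNat 2,
      ← ENNReal.ofReal_div_of_pos two_pos]
    refine ENNReal.ofReal_le_ofReal ?_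
    have ht : 0 ≤ E.toReal := ENNReal.toReal_nonneg
    rw [hθ_def, div_mul_eq_mul_div, div_le_div_iff₀ (by positivity) two_pos]
    nlinarith
  have h1θE : ENNReal.ofReal (1 + θ) * E ≤ E + ε' / 2 := by
    rw [ENNReal.ofReal_add zero_le_one hθ.le, ENNReal.ofReal_one, add_mul, one_mul]
    exact add_le_add le_rfl hθE
  -- the cutoff constant `A` and the layer tolerance `τ`
  obtain ⟨A, hA⟩ := stub_coreCutoff N
  obtain ⟨c, hc⟩ : ∃ c : ℝ≥0∞, c =
      2 * (ENNReal.ofReal (1 + θ⁻¹) * ENNReal.ofReal (144 * (A : ℝ))) * ((N : ℝ≥0∞) * N) +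
        (N : ℝ≥0∞) * ((N : ℝ≥0∞) * ENNReal.ofReal (144 * (b / 82) ^ 2)) := ⟨_, rfl⟩
  have hct : c ≠ ⊤ := by rw [hc]; finiteness
  obtain ⟨τ, hτ, hcτ⟩ : ∃ τ : ℝ≥0∞, 0 < τ ∧ c * τ ≤ ε' / 2 :=
    ⟨(ε' / 2) / c, ENNReal.div_pos hε2 hct, ENNReal.mul_div_le⟩
  -- the layer width `s` and the cutoff width `δ`
  obtain ⟨s, hs, hsτ⟩ := stub_layerKineticVanishing N b ψ hψC hkin τ hτ
  obtain ⟨δ, hδ_def⟩ : ∃ δ : ℝ, δ = min (s / 2) (b / 82) := ⟨_, rfl⟩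
  have hδ : 0 < δ := by rw [hδ_def]; exact lt_min (by positivity) (by positivity)
  have hδs : 2 * δ ≤ s := by have := min_le_left (s / 2) (b / 82); rw [hδ_def]; linarith
  have hδb' : δ ≤ b / 82 := by rw [hδ_def]; exact min_le_right _ _
  have hδb : 82 * δ ≤ b := by linarith
  have hδ0 : δ ≠ 0 := hδ.ne'
  -- the layer `Λ = {some pair in (b - 2δ, b + 2δ)}`, its kinetic energy and its mass
  set Λ : Set (Config N) :=
    {Y | ∃ i j : Fin N, i ≠ j ∧ Y ∈ shellPair (b - 2 * δ) (4 * δ) i j} with hΛ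
  have hΛm : MeasurableSet Λ := measurableSet_pairShells _ _
  have hΛkin : ∫⁻ X, Λ.indicator (kineticDensity ψ) X ≤ τ := by
    refine (lintegral_mono fun X => indicator_le_indicator_of_subset ?_ (fun _ => zero_le) X).trans
      hsτ
    rintro Y ⟨i, j, hij, h1, h2⟩
    exact ⟨i, j, hij, by linarith, by linarith⟩
  have hΛmass : ∫⁻ X, Λ.indicator (fun Y => (‖ψ Y‖₊ : ℝ≥0∞) ^ 2) X ≤
      (N : ℝ≥0∞) * ((N : ℝ≥0∞) * (ENNReal.ofReal (9 * (4 * δ) ^ 2) * τ)) :=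
    (lintegral_wallLayer_le (a := b - 2 * δ) (δ := 4 * δ) (r₀ := b) (by linarith) (by linarith)
      (by linarith) (by linarith) (by linarith) hψC hzero).trans
      (mul_le_mul' le_rfl (mul_le_mul' le_rfl (mul_le_mul' le_rfl hΛkin)))
  have hGA : ENNReal.ofReal ((A : ℝ) / δ ^ 2) * ENNReal.ofReal (9 * (4 * δ) ^ 2) =
      ENNReal.ofReal (144 * (A : ℝ)) := by
    rw [← ENNReal.ofReal_mul (by positivity)]
    congr 1
    field_simp
    ring
  -- the two pair cutoffs of Stub 15a
  obtain ⟨χ, hχC, hχ01, hχσ, hχ0, hχ1, hχA⟩ := hA (b + δ) (b + 2 * δ) (by linarith) (by linarith)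
  obtain ⟨χ', hχ'C, hχ'01, hχ'σ, hχ'0, hχ'1, hχ'A⟩ :=
    hA (b - 2 * δ) (b - δ) (by linarith) (by linarith)
  have hχd : Differentiable ℝ χ := hχC.differentiable one_ne_zero
  have hχ'd : Differentiable ℝ χ' := hχ'C.differentiable one_ne_zero
  have hGχ : ∀ X, realKinetic χ X ≤
      Λ.indicator (fun _ => ENNReal.ofReal ((A : ℝ) / δ ^ 2)) X := by
    intro X
    refine (hχA X).trans ?_
    by_cases hX : X ∈ {Y : Config N | ∃ i j : Fin N, i ≠ j ∧ b + δ < dist (Y i) (Y j) ∧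
        dist (Y i) (Y j) < b + 2 * δ}
    · have hXΛ : X ∈ Λ := by
        obtain ⟨i, j, hij, h1, h2⟩ := hX
        exact ⟨i, j, hij, by linarith, by linarith⟩
      rw [indicator_of_mem hX, indicator_of_mem hXΛ, show b + 2 * δ - (b + δ) = δ by ring]
    · rw [indicator_of_notMem hX]
      exact zero_le
  have hGχ' : ∀ X, realKinetic χ' X ≤
      Λ.indicator (fun _ => ENNReal.ofReal ((A : ℝ) / δ ^ 2)) X := by
    intro X
    refine (hχ'A X).trans ?_
    by_cases hX : X ∈ {Y : Config N | ∃ i j : Fin N, i ≠ j ∧ b - 2 * δ < dist (Y i) (Y j) ∧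
        dist (Y i) (Y j) < b - δ}
    · have hXΛ : X ∈ Λ := by
        obtain ⟨i, j, hij, h1, h2⟩ := hX
        exact ⟨i, j, hij, by linarith, by linarith⟩
      rw [indicator_of_mem hX, indicator_of_mem hXΛ, show b - δ - (b - 2 * δ) = δ by ring]
    · rw [indicator_of_notMem hX]
      exact zero_le
  -- nesting of the cutoffs and agreement off the layer
  have hnest : ∀ X, χ X = 0 ∨ χ' X = 1 := by
    intro X
    by_cases h : ∃ i j : Fin N, i ≠ j ∧ dist (X i) (X j) ≤ b + δ
    · exact Or.inl (hχ0 X h)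
    · refine Or.inr (hχ'1 X fun i j hij => ?_)
      by_contra hlt
      exact h ⟨i, j, hij, by linarith [not_le.1 hlt]⟩
  have hagree : ∀ X, X ∉ Λ → χ X = χ' X := by
    intro X hX
    by_cases h : ∃ i j : Fin N, i ≠ j ∧ dist (X i) (X j) ≤ b - 2 * δ
    · obtain ⟨i, j, hij, hd⟩ := h
      rw [hχ'0 X ⟨i, j, hij, hd⟩, hχ0 X ⟨i, j, hij, by linarith⟩]
    · have hfar : ∀ i j : Fin N, i ≠ j → b + 2 * δ ≤ dist (X i) (X j) := by
        intro i j hij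
        by_contra hlt
        have h1 : b - 2 * δ < dist (X i) (X j) := by
          by_contra hle
          exact h ⟨i, j, hij, not_lt.1 hle⟩
        exact hX ⟨i, j, hij, h1, by linarith [not_le.1 hlt]⟩
      rw [hχ1 X hfar, hχ'1 X fun i j hij => by linarith [hfar i j hij]]
  -- the two pieces
  set fU : Config N → ℂ := fun X => (χ X : ℂ) * ψ X with hfU
  set fB : Config N → ℂ := fun X => ((1 - χ' X : ℝ) : ℂ) * ψ X with hfB
  have hfUC : ContDiff ℝ 1 fU := (Complex.ofRealCLM.contDiff.comp hχC).mul hψC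
  have hfBC : ContDiff ℝ 1 fB :=
    (Complex.ofRealCLM.contDiff.comp (contDiff_const.sub hχ'C)).mul hψC
  refine ⟨fU, fB, hfUC, hfBC, fun X hX => ?_, fun X hX => ?_, fun σ X => ?_, fun σ X => ?_,
    fun X hX => ?_, fun X hX => ?_, ?_, ?_⟩
  · simp only [hfU, hψ0 X hX, mul_zero]
  · simp only [hfB, hψ0 X hX, mul_zero]
  · simp only [hfU, hχσ σ X, hψσ σ X]
  · simp only [hfB, hχ'σ σ X, hψσ σ X]
  · obtain ⟨i, j, hij, hd⟩ := hX
    simp only [hfU, hχ0 X ⟨i, j, hij, by linarith⟩, Complex.ofReal_zero, zero_mul]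
  · simp only [hfB, hχ'1 X fun i j hij => by linarith [hX i j hij], sub_self,
      Complex.ofReal_zero, zero_mul]
  · -- the `L²`-distance
    have h144 : 9 * (4 * δ) ^ 2 = 144 * δ ^ 2 := by ring
    have hsq : δ ^ 2 ≤ (b / 82) ^ 2 := pow_le_pow_left₀ hδ.le hδb' 2
    calc ∫⁻ X, (‖ψ X - (fU X + fB X)‖₊ : ℝ≥0∞) ^ 2
        ≤ ∫⁻ X, Λ.indicator (fun Y => (‖ψ Y‖₊ : ℝ≥0∞) ^ 2) X :=
          lintegral_mono fun X => dist_pt hχ01 hχ'01 hagree X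
      _ ≤ (N : ℝ≥0∞) * ((N : ℝ≥0∞) * (ENNReal.ofReal (9 * (4 * δ) ^ 2) * τ)) := hΛmass
      _ ≤ (N : ℝ≥0∞) * ((N : ℝ≥0∞) * (ENNReal.ofReal (144 * (b / 82) ^ 2) * τ)) := by
          rw [h144]
          exact mul_le_mul' le_rfl (mul_le_mul' le_rfl
            (mul_le_mul' (ENNReal.ofReal_le_ofReal (by linarith)) le_rfl))
      _ = (N : ℝ≥0∞) * ((N : ℝ≥0∞) * ENNReal.ofReal (144 * (b / 82) ^ 2)) * τ := by ring
      _ ≤ c * τ := mul_le_mul' (by rw [hc]; exact le_add_self) le_rfl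
      _ ≤ ε' / 2 := hcτ
      _ ≤ ε' := ENNReal.half_le_self
  · -- the energy
    have hmeasU : Measurable fun X =>
        kineticDensity fU X + interaction v X * (‖fU X‖₊ : ℝ≥0∞) ^ 2 :=
      measurable_energyDensity hv hfUC.continuous
    have hmeasE : Measurable fun X => ENNReal.ofReal (1 + θ) *
        (kineticDensity ψ X + interaction v X * (‖ψ X‖₊ : ℝ≥0∞) ^ 2) :=
      (measurable_energyDensity hv hψC.continuous).const_mul _
    have hmeasΛ : Measurable fun X => Λ.indicator (fun Y => (‖ψ Y‖₊ : ℝ≥0∞) ^ 2) X :=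
      (measurable_ennnormSq hψC.continuous).indicator hΛm
    calc rawEnergy v fU + rawEnergy v fB
        = ∫⁻ X, (kineticDensity fU X + interaction v X * (‖fU X‖₊ : ℝ≥0∞) ^ 2) +
            (kineticDensity fB X + interaction v X * (‖fB X‖₊ : ℝ≥0∞) ^ 2) := by
          unfold rawEnergy
          rw [lintegral_add_left hmeasU]
      _ ≤ ∫⁻ X, ENNReal.ofReal (1 + θ) *
              (kineticDensity ψ X + interaction v X * (‖ψ X‖₊ : ℝ≥0∞) ^ 2) +
            2 * (ENNReal.ofReal (1 + θ⁻¹) * ENNReal.ofReal ((A : ℝ) / δ ^ 2)) *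
              Λ.indicator (fun Y => (‖ψ Y‖₊ : ℝ≥0∞) ^ 2) X :=
          lintegral_mono fun X =>
            energy_pt hψd hχd hχ'd hχ01 hχ'01 hnest hθ hGχ hGχ' (interaction v) X
      _ = ENNReal.ofReal (1 + θ) *
              (∫⁻ X, kineticDensity ψ X + interaction v X * (‖ψ X‖₊ : ℝ≥0∞) ^ 2) +
            2 * (ENNReal.ofReal (1 + θ⁻¹) * ENNReal.ofReal ((A : ℝ) / δ ^ 2)) *
              ∫⁻ X, Λ.indicator (fun Y => (‖ψ Y‖₊ : ℝ≥0∞) ^ 2) X := by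
          rw [lintegral_add_left hmeasE,
            lintegral_const_mul _ (measurable_energyDensity hv hψC.continuous),
            lintegral_const_mul _ hmeasΛ]
      _ ≤ (E + ε' / 2) + 2 * (ENNReal.ofReal (1 + θ⁻¹) * ENNReal.ofReal ((A : ℝ) / δ ^ 2)) *
            ((N : ℝ≥0∞) * ((N : ℝ≥0∞) * (ENNReal.ofReal (9 * (4 * δ) ^ 2) * τ))) :=
          add_le_add h1θE (mul_le_mul' le_rfl hΛmass)
      _ = (E + ε' / 2) + 2 * (ENNReal.ofReal (1 + θ⁻¹) *
            (ENNReal.ofReal ((A : ℝ) / δ ^ 2) * ENNReal.ofReal (9 * (4 * δ) ^ 2))) *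
              ((N : ℝ≥0∞) * N) * τ := by ring
      _ = (E + ε' / 2) + 2 * (ENNReal.ofReal (1 + θ⁻¹) * ENNReal.ofReal (144 * (A : ℝ))) *
              ((N : ℝ≥0∞) * N) * τ := by rw [hGA]
      _ ≤ (E + ε' / 2) + c * τ :=
          add_le_add le_rfl (mul_le_mul' (by rw [hc]; exact le_self_add) le_rfl)
      _ ≤ (E + ε' / 2) + ε' / 2 := add_le_add le_rfl hcτ
      _ = E + ε' := by rw [add_assoc, ENNReal.add_halves]

end Summit.AtomisticToContinuum.BoseEinsteinCondensation.Theorems.GroundStateRigidity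

end
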